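import Summits.ResolutionOfSingularities.ResolutionOfSingularities.Theorems.ValuativeLuAlphaPTorsorToroidalExit
import Summits.ResolutionOfSingularities.ResolutionOfSingularities.Theorems.ValuativeLuAlphaPTorsorSequenceModel
import Literature.AlgebraicGeometry.Resolution.RsopMonomialIdeals
import Literature.AlgebraicGeometry.Resolution.NormalCrossingsBlowupStepReduction
import Literature.AlgebraicGeometry.Resolution.ArithmeticalThreefolds

/-!
# Crux `Steer` (stmt-ResolutionOfSingularities-16345), line `switching-dichotomy`: the switching exit

Stub `stub_switchingExit` of the lead's skeleton `Cruxes/Steer/Lines/switching_dichotomy.lean`,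
PROVED here (statement verbatim from the ledger registration).

**Statement.** `A₀ ⊆ O` a finitely generated `k`-subalgebra of the valued field `(K, O)`,
`char k = p`, `t ^ p ∈ A₀`, `Frac (A₀[t]) = K`; `R : ℕ → Subring K` the sequence of quadratic
transforms along `O` of `R 0 = (A₀)_{𝔪_O ∩ A₀}`. If in the member `R N` the shifted radicand has a
toroidal presentation `t ^ p - g ^ p = ∏ z_l ^ {m_l} · u` with `z` part of a regular system of
parameters, `u` a unit, `g ∈ R N` and some `p ∤ m_l`, then some finitely generated `A ⊇ A₀` with
`t ∈ A ⊆ O`, `Frac A = K` is regular at the centre of `O`.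

**Proof.** `R N` is the local ring at the centre of a finitely generated model `A₀ ≤ A₁ ⊆ O`
(`exists_model_of_sequence_member` with `ι = id`), i.e. `e : R N ≃ L := (A₁)_{𝔪_O ∩ A₁}`
compatibly with the structure map on `A₁`. Transport the part `z` along `e`
(`IsRsopPart.map_ringEquiv`), complete it to a regular system of parameters of `L`, pad the
exponents by zeros, transport the unit and the relation, and apply the landed toroidal exit
`stub_toroidalExit` (datum `c := e g`) to `A₁`; finally `A₀ ≤ A₁ ≤ A`.
-/

-- `Summit.<S>.<S>.…` duplicates the summit name by design (single-problem summit).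
set_option linter.dupNamespace false

namespace Summit.ResolutionOfSingularities.ResolutionOfSingularities.Theorems.SwitchingDichotomy

open IsLocalRing Literature.AlgebraicGeometry.Resolution
open Summit.ResolutionOfSingularities.ResolutionOfSingularities.Theorems.PfaffLine

/-- **Stub `stub_switchingExit` of the line `switching-dichotomy`** (crux `Steer`,
stmt-ResolutionOfSingularities-16345). A monomial presentation `t ^ p − g ^ p = ∏ z_l ^ m_l · u` of
the shifted radicand in a member `R N` of the quadratic sequence of the base along `O` (`z` part of
a regular system of parameters, `u` a unit, some `p ∤ m_l`) gives torsor local uniformization: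
`R N ≃ (A₁)_{centre}` for a finitely generated model `A₀ ≤ A₁ ⊆ O`, along which the datum is
transported to the toroidal exit `stub_toroidalExit`. [cite: Kato1994, (10.4)] -/
theorem stub_switchingExit (p : ℕ) (hp : p.Prime) (k K : Type) [Field k] [CharP k p] [Field K]
    [Algebra k K] (O : ValuationSubring K) (A₀ : Subalgebra k K) (h₀ : A₀.toSubring ≤ O.toSubring)
    (t : K) (hfg : A₀.FG) (htp : t ^ p ∈ A₀)
    (hfr : IsFractionRing (Algebra.adjoin k (insert t (A₀ : Set K))) K)
    (R : ℕ → Subring K) (hR0 : R 0 = locAtCentre A₀.toSubring O)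
    (hstep : ∀ i, IsQuadraticTransformAlong O (R i) (R (i + 1)))
    (N : ℕ) [IsLocalRing (R N)] (s : ℕ) (z : Fin s → R N) (hz : IsRsopPart z)
    (g : K) (hg : g ∈ R N) (m : Fin s → ℕ) (hm : ∃ l, ¬ p ∣ m l) (u : R N) (hu : IsUnit u)
    (hrel : t ^ p - g ^ p = (∏ l, ((z l : R N) : K) ^ m l) * (u : K)) :
    ∃ (A : Subalgebra k K) (h : A.toSubring ≤ O.toSubring), A₀ ≤ A ∧ t ∈ A ∧ A.FG ∧
      IsFractionRing A K ∧ IsRegularLocalRing (Localization.AtPrime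
        (Ideal.comap (Subring.inclusion h) (IsLocalRing.maximalIdeal O))) := by
  -- ### (1) `R N` is the local ring at the centre of a finitely generated model `A₀ ≤ A₁ ⊆ O`
  have hO : O.comap (RingHom.id K) = O := by
    ext x
    rfl
  have hS : A₀.toSubring.comap (RingHom.id K) = A₀.toSubring := by
    ext x
    rfl
  obtain ⟨A₁, h₁, hle, hfg₁, -, -, e, he⟩ := exists_model_of_sequence_member k K K (RingHom.id K)
    O A₀ h₀ hfg (fun x _ => RingHom.mem_range.mpr ⟨x, rfl⟩) R (by rw [hO, hS]; exact hR0)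
    (by rw [hO]; exact hstep) N
  -- ### (2) transport of the part of a regular system of parameters, completed to a full one
  obtain ⟨hL, e', y, hdim, hspan⟩ := hz.map_ringEquiv e
  -- `t ^ p ∈ A₀ ≤ R 0 ≤ R N`
  have htR : t ^ p ∈ R N := by
    refine sequence_monotone hstep (Nat.zero_le N) ?_
    rw [hR0]
    exact le_locAtCentre A₀.toSubring O htp
  -- the relation inside the subring `R N`
  have hrelR : (⟨t ^ p, htR⟩ : R N) - ⟨g, hg⟩ ^ p = (∏ l, z l ^ m l) * u := by
    apply Subtype.ext
    push_cast
    exact hrel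
  -- and inside `L`
  have key : e ⟨t ^ p, htR⟩ = algebraMap A₁.toSubring (Localization.AtPrime
      (Ideal.comap (Subring.inclusion h₁) (IsLocalRing.maximalIdeal O))) ⟨t ^ p, hle htp⟩ :=
    he _ (hle htp)
  have hrelL : algebraMap A₁.toSubring (Localization.AtPrime
      (Ideal.comap (Subring.inclusion h₁) (IsLocalRing.maximalIdeal O))) ⟨t ^ p, hle htp⟩ -
        (e ⟨g, hg⟩) ^ p = (∏ i, Fin.append (e ∘ z) y i ^ Fin.append m (fun _ => 0) i) * e u := by
    rw [← key, Fin.prod_trunc _ (fun j => by simp), ← map_pow, ← map_sub, hrelR, map_mul, map_prod]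
    simp
  -- the completed family generates the maximal ideal
  have hspan' : Ideal.span (Set.range (Fin.append (e ∘ z) y)) = maximalIdeal (Localization.AtPrime
      (Ideal.comap (Subring.inclusion h₁) (IsLocalRing.maximalIdeal O))) := by
    rw [← hspan]
    congr 1
    ext a
    constructor
    · rintro ⟨i, rfl⟩
      induction i using Fin.addCases with
      | left j => exact Or.inl ⟨j, by simp⟩
      | right j => exact Or.inr ⟨j, by simp⟩
    · rintro (⟨j, rfl⟩ | ⟨j, rfl⟩)
      · exact ⟨Fin.castAdd e' j, by simp⟩
      · exact ⟨Fin.natAdd s j, by simp⟩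
  -- ### (3) the toroidal exit over the model `A₁`
  have hfr₁ : IsFractionRing (Algebra.adjoin k (insert t (A₁ : Set K))) K :=
    isFractionRing_of_le (Algebra.adjoin_mono (Set.insert_subset_insert fun x hx => hle hx)) hfr
  obtain ⟨l, hl⟩ := hm
  obtain ⟨A, h, hA₁A, htA, hAfg, hAfr, hreg⟩ := stub_toroidalExit p hp k K O A₁ h₁ t hfg₁ (hle htp)
    hfr₁ hL ⟨e ⟨g, hg⟩, s + e', Fin.append (e ∘ z) y, Fin.append m (fun _ => 0), e u, hspan', hdim,
      hu.map e, ⟨Fin.castAdd e' l, by simpa using hl⟩, hrelL⟩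
  exact ⟨A, h, hle.trans hA₁A, htA, hAfg, hAfr, hreg⟩

end Summit.ResolutionOfSingularities.ResolutionOfSingularities.Theorems.SwitchingDichotomy
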